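import Literature.NumberTheory.DiophantineGeometry.FunctionFieldDivisorsNegativeDegreeProofs
import Mathlib.LinearAlgebra.Matrix.Determinant.Basic
import HarnessLib

/-!
# Roy–Waldschmidt 1997, §4 (preamble): heights over a function field of one variable, Lemme 4.2

D. Roy, M. Waldschmidt, *Approximation diophantienne et indépendance algébrique de logarithmes*,
Ann. Sci. ÉNS (4) 30 (1997) 753–796, §4 "Relèvement du sous-groupe obstructeur", pp. 772–773.

Throughout §4–§5 of the paper `K ⊂ ℂ` is a field finitely generated and of transcendence degree
`1` over `ℚ`, "donc un corps de fonctions en une variable sur `ℚ`", and the authors use the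
function-field height (p. 772):

> "Étant donné un entier positif `n`, un point non nul `x = (x₀, …, xₙ)` de `Kⁿ⁺¹` et une place
> non triviale `q` de `K` sur `ℚ`, on définit l'ordre de `x` en `q` par
> `ord_q(x) = min{ord_q(x₀), …, ord_q(xₙ)}`.  On définit aussi la hauteur du point projectif
> `(x₀ : … : xₙ)` par `h(x₀ : … : xₙ) = -∑_q ord_q(x) deg(q)` (somme sur toutes les places non
> triviales `q` de `K` sur `ℚ`).  Enfin `h₁(x₁, …, xₙ) = h(1 : x₁ : … : xₙ)` … C'est simplement le
> degré du ppcm des diviseurs des pôles de `x₁, …, xₙ`."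

and (p. 773) "Si `x` est un élément non nul de `K`, alors `h₁(x)` est le degré commun des
diviseurs des pôles et des zéros de `x`", followed by

> **Lemme 4.2.** Soit `x` un élément non nul de `K`. Si `h₁(x) < D`, alors on a `x ∈ 𝒪` et
> `x̄ ≠ 0` (`𝒪` the valuation ring of the fixed place `𝔭` of degree `D`, `x̄` the reduction).

This file formalizes exactly this preamble, for an arbitrary constant field `k` in place of `ℚ`,
on top of the tree's library of algebraic function fields of one variable
(`Literature.NumberTheory.DiophantineGeometry.AlgFunctionField`: places `PlaceOver k K`, the
normalised order `PlaceOver.ord`, the degree `PlaceOver.degree`, the product formula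
`degree_principalDivisor_eq_zero`, finiteness of zeros and poles
`finite_setOf_ord_ne_zero_of_ne_zero` — all proved there):

* `ordVec q x` — `ord_q(x) = min ord_q(xᵢ)` over the **nonzero** coordinates (the library's
  `ord_q 0 = 0` is a junk value where the paper has `+∞`), `ordVec q 0 = 0`;
* `projHeight k x = -∑_q ord_q(x) deg q` (a `finsum`; finite support
  `finite_setOf_ordVec_ne_zero`), its projective invariance `projHeight_smul` (product formula),
  `projHeight_nonneg`, and `projHeight_eq_zero_of_isAlgebraic` ("pour tout sous-espace défini
  sur `ℚ` on a `h(V) = 0`" rests on this);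
* `affHeight k x = h₁(x) = ∑_q max{0, -ord_q(x)} deg q` with `affHeight_eq_projHeight`
  (`h₁(x) = h(1 : x)`), the valuation-wise comparison principles `affHeight_le_of_forall`,
  `affHeight_le_add_of_forall`, `affHeight_le_sum_of_forall` and their consequences
  (`affHeight_mul_le`, `affHeight_prod_le`, `affHeight_inv`, `affHeight_zpow_le`,
  `affHeight_add_le`, `affHeight_sub_one_le`, `affHeight_apply_le`, `affHeight_le_sum_apply`,
  `affHeight_det_le` — the estimate `h₁(Δ) ≤ ∑ⱼ h₁(wⱼ)` of step 4 of the proof of Théorème 4.1,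
  p. 777);
* `sum_posPart_ord_eq_sum_negPart_ord` — "`h₁(x)` est le degré commun des diviseurs des pôles et
  des zéros de `x`";
* **Lemme 4.2**: `ord_eq_zero_of_affHeight_lt_degree`, `lemme_4_2`
  (`x ∈ 𝒪_𝔭` and `x̄ ≠ 0`).

Everything is proved; no named facts are introduced.  (Socket contribution of the seat holding
`Literature.NumberTheory.Transcendental.royWaldschmidt_quadraticForm_ne_zero_of_trdeg_one` to the
chain proving `Literature.NumberTheory.Transcendental.royWaldschmidt_quadratic_thm_0_2`; the
heights of subspaces and Lemmes 4.3–4.7 follow in sibling files.)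

## References

* [RoyWaldschmidt1997ENS] D. Roy, M. Waldschmidt, Ann. Sci. ÉNS (4) 30 (1997) 753–796, §4,
  pp. 772–773 (definitions of `ord_q(x)`, `h`, `h₁`; Lemme 4.2), p. 777 (step 4).
* H. Stichtenoth, *Algebraic Function Fields and Codes*, GTM 254 (2009), §1.4 (Thm. 1.4.11:
  `deg (x)₀ = deg (x)_∞`), the source of the function-field library used here.
-/

noncomputable section

open scoped Classical

namespace Literature.NumberTheory.Transcendental

namespace RoyWaldschmidt1997

open Literature.NumberTheory.DiophantineGeometry
open Literature.NumberTheory.DiophantineGeometry.AlgFunctionField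

universe u v

variable {k : Type u} {K : Type v} [Field k] [Field K] [Algebra k K]
variable {ι : Type*} [Fintype ι]

/-! ### The order of a tuple at a place -/

/-- The set of indices of the nonzero coordinates of a tuple. [folklore] -/
def nzSupport (x : ι → K) : Finset ι := Finset.univ.filter fun i ↦ x i ≠ 0

/-- Membership in the nonzero support. [folklore] -/
theorem mem_nzSupport {x : ι → K} {i : ι} : i ∈ nzSupport x ↔ x i ≠ 0 := by
  simp [nzSupport]

/-- The nonzero support is nonempty iff the tuple is nonzero. [folklore] -/
theorem nzSupport_nonempty_iff {x : ι → K} : (nzSupport x).Nonempty ↔ x ≠ 0 := by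
  constructor
  · rintro ⟨i, hi⟩ rfl
    exact (mem_nzSupport.1 hi) rfl
  · intro hx
    obtain ⟨i, hi⟩ := Function.ne_iff.1 hx
    exact ⟨i, mem_nzSupport.2 hi⟩

/-- Scaling by a nonzero constant does not change the nonzero support. [folklore] -/
theorem nzSupport_smul {x : ι → K} {c : K} (hc : c ≠ 0) : nzSupport (c • x) = nzSupport x := by
  ext i
  simp [mem_nzSupport, hc]

/-- The junk value of the library's normalised order at `0`: `ord_q(0) = 0` (the paper's
`ord_q(0) = +∞` is never used: orders of tuples are taken over nonzero coordinates). [folklore] -/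
theorem ord_zero_eq (q : PlaceOver k K) : q.ord (0 : K) = 0 := by
  rw [PlaceOver.ord_of_mem q (zero_mem _)]
  have h0 : (⟨(0 : K), zero_mem _⟩ : q.toValuationSubring) = 0 := rfl
  rw [h0, IsDiscreteValuationRing.addVal_zero]
  simp

/-- **`ord_q(x)`** for a tuple `x = (xᵢ)` over the function field `K/k` and a place `q` of `K/k`:
the minimum of `ord_q(xᵢ)` over the *nonzero* coordinates `xᵢ` (Roy–Waldschmidt:
`ord_q(x) = min{ord_q(x₀), …, ord_q(xₙ)}` for `x ≠ 0`, with the convention `ord_q(0) = +∞`);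
junk value `0` for `x = 0`. [cite: RoyWaldschmidt1997ENS, §4, p. 772] -/
def ordVec (q : PlaceOver k K) (x : ι → K) : ℤ :=
  if h : (nzSupport x).Nonempty then (nzSupport x).inf' h (fun i ↦ q.ord (x i)) else 0

/-- Unfolding of `ordVec` on a nonzero tuple: the minimum of the orders of the nonzero coordinates.
[cite: RoyWaldschmidt1997ENS, §4, p. 772] -/
theorem ordVec_of_ne_zero (q : PlaceOver k K) {x : ι → K} (hx : x ≠ 0) :
    ordVec q x = (nzSupport x).inf' (nzSupport_nonempty_iff.2 hx) (fun i ↦ q.ord (x i)) := by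
  rw [ordVec, dif_pos (nzSupport_nonempty_iff.2 hx)]

/-- Junk value: `ordVec q 0 = 0`. [folklore] -/
@[simp]
theorem ordVec_zero (q : PlaceOver k K) : ordVec q (0 : ι → K) = 0 := by
  rw [ordVec, dif_neg]
  exact fun h ↦ (nzSupport_nonempty_iff.1 h) rfl

/-- `ord_q(x) ≤ ord_q(xᵢ)` for every nonzero coordinate. [cite: RoyWaldschmidt1997ENS, §4, p. 772] -/
theorem ordVec_le (q : PlaceOver k K) {x : ι → K} {i : ι} (hi : x i ≠ 0) :
    ordVec q x ≤ q.ord (x i) := by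
  have hx : x ≠ 0 := fun h ↦ hi (by simp [h])
  rw [ordVec_of_ne_zero q hx]
  exact Finset.inf'_le _ (mem_nzSupport.2 hi)

/-- The minimum is attained: `ord_q(x) = ord_q(xᵢ)` for some nonzero coordinate.
[cite: RoyWaldschmidt1997ENS, §4, p. 772] -/
theorem exists_ordVec_eq (q : PlaceOver k K) {x : ι → K} (hx : x ≠ 0) :
    ∃ i, x i ≠ 0 ∧ ordVec q x = q.ord (x i) := by
  rw [ordVec_of_ne_zero q hx]
  obtain ⟨i, hi, h⟩ := Finset.exists_mem_eq_inf' (nzSupport_nonempty_iff.2 hx)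
    (fun i ↦ q.ord (x i))
  exact ⟨i, mem_nzSupport.1 hi, h⟩

/-- `m ≤ ord_q(x)` iff `m ≤ ord_q(xᵢ)` for every nonzero coordinate. [cite: RoyWaldschmidt1997ENS, §4, p. 772] -/
theorem le_ordVec_iff (q : PlaceOver k K) {x : ι → K} (hx : x ≠ 0) {m : ℤ} :
    m ≤ ordVec q x ↔ ∀ i, x i ≠ 0 → m ≤ q.ord (x i) := by
  rw [ordVec_of_ne_zero q hx, Finset.le_inf'_iff]
  simp only [mem_nzSupport]

/-- `ord_q(c x) = ord_q(c) + ord_q(x)` for `c ≠ 0`, `x ≠ 0`. [cite: RoyWaldschmidt1997ENS, §4, p. 772] -/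
theorem ordVec_smul (q : PlaceOver k K) {x : ι → K} (hx : x ≠ 0) {c : K} (hc : c ≠ 0) :
    ordVec q (c • x) = q.ord c + ordVec q x := by
  have hcx : c • x ≠ 0 := smul_ne_zero hc hx
  refine le_antisymm ?_ ?_
  · obtain ⟨i, hi, h⟩ := exists_ordVec_eq q hx
    rw [h, ← q.ord_mul_eq hc hi]
    exact ordVec_le q (by simp [hc, hi])
  · rw [le_ordVec_iff q hcx]
    intro i hi
    have hi' : x i ≠ 0 := by simpa [hc] using hi
    rw [Pi.smul_apply, smul_eq_mul, q.ord_mul_eq hc hi']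
    exact add_le_add le_rfl (ordVec_le q hi')

/-- A tuple with a single (nonzero) value: `ord_q((a, …, a)) = ord_q(a)`. [folklore] -/
theorem ordVec_const [Nonempty ι] (q : PlaceOver k K) (a : K) :
    ordVec q (fun _ : ι ↦ a) = q.ord a := by
  by_cases ha : a = 0
  · simp only [ha]
    rw [show (fun _ : ι ↦ (0 : K)) = 0 from rfl, ordVec_zero, ord_zero_eq]
  · have hx : (fun _ : ι ↦ a) ≠ 0 := fun h ↦ ha (by simpa using congr_fun h (Classical.arbitrary ι))
    refine le_antisymm (ordVec_le q (i := Classical.arbitrary ι) ha) ?_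
    rw [le_ordVec_iff q hx]
    intro i _
    exact le_rfl

/-- For a single element: `ord_q((a)) = ord_q(a)`. [folklore] -/
@[simp]
theorem ordVec_vecSingle (q : PlaceOver k K) (a : K) : ordVec q ![a] = q.ord a := by
  have : (![a] : Fin 1 → K) = fun _ ↦ a := by ext i; fin_cases i; rfl
  rw [this, ordVec_const]

/-- If `ord_q(x) ≠ 0` then `ord_q(xᵢ) ≠ 0` for some nonzero coordinate. [folklore] -/
theorem exists_ord_ne_zero_of_ordVec_ne_zero (q : PlaceOver k K) {x : ι → K}
    (h : ordVec q x ≠ 0) : ∃ i, x i ≠ 0 ∧ q.ord (x i) ≠ 0 := by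
  by_cases hx : x = 0
  · exact (h (by rw [hx, ordVec_zero])).elim
  · obtain ⟨i, hi, hq⟩ := exists_ordVec_eq q hx
    exact ⟨i, hi, hq ▸ h⟩

/-- **Finiteness of the support of `q ↦ ord_q(x)`** in an algebraic function field of one
variable: only finitely many places are zeros or poles of some coordinate (Stichtenoth
Cor. 1.3.4, `finite_setOf_ord_ne_zero_of_ne_zero`). [cite: RoyWaldschmidt1997ENS, §4, p. 772] -/
theorem finite_setOf_ordVec_ne_zero [IsAlgFunctionField k K] (x : ι → K) :
    {q : PlaceOver k K | ordVec q x ≠ 0}.Finite := by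
  refine Set.Finite.subset ((nzSupport x).finite_toSet.biUnion
    (t := fun i ↦ {q : PlaceOver k K | q.ord (x i) ≠ 0})
    fun i hi ↦ finite_setOf_ord_ne_zero_of_ne_zero (K := k) (mem_nzSupport.1 hi)) ?_
  intro q hq
  obtain ⟨i, hi, hq'⟩ := exists_ord_ne_zero_of_ordVec_ne_zero q hq
  simp only [Set.mem_iUnion, Set.mem_setOf_eq, Finset.mem_coe]
  exact ⟨i, mem_nzSupport.2 hi, hq'⟩

/-! ### The product formula as a finite sum -/

/-- **Product formula** over a finite set of places containing the zeros and poles of `a ≠ 0`: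
`∑_q ord_q(a) deg q = 0` (Stichtenoth Thm. 1.4.11, `degree_principalDivisor_eq_zero`).
[cite: RoyWaldschmidt1997ENS, §4, p. 773] -/
theorem sum_ord_mul_degree_eq_zero [IsAlgFunctionField k K] {a : K} (ha : a ≠ 0)
    (T : Finset (PlaceOver k K)) (hT : ∀ q : PlaceOver k K, q.ord a ≠ 0 → q ∈ T) :
    ∑ q ∈ T, q.ord a * (q.degree : ℤ) = 0 := by
  have h0 := degree_principalDivisor_eq_zero (K := k) ha
  rw [Divisor.degree_apply] at h0
  rw [← h0, Finsupp.sum_of_support_subset _ (s := T)]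
  · refine Finset.sum_congr rfl fun q _ ↦ ?_
    rw [principalDivisor_apply_of_ne_zero ha]
  · intro q hq
    rw [Finsupp.mem_support_iff, principalDivisor_apply_of_ne_zero ha] at hq
    exact hT q hq
  · intro q _
    simp

/-! ### The projective height -/

variable (k) in
/-- **The (function-field) height of a projective point** `(x₀ : … : xₙ)` with coordinates in
`K`: `h(x) = -∑_q ord_q(x) deg(q)`, the sum over all places `q` of `K/k` (a finite sum,
`finite_setOf_ordVec_ne_zero`; written as a `finsum`). `h(0) = 0` by the junk value
`ordVec q 0 = 0`. [cite: RoyWaldschmidt1997ENS, §4, p. 772] -/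
def projHeight (x : ι → K) : ℤ :=
  ∑ᶠ q : PlaceOver k K, -(ordVec q x * (q.degree : ℤ))

/-- Junk value: `h(0) = 0`. [folklore] -/
@[simp]
theorem projHeight_zero : projHeight k (0 : ι → K) = 0 := by
  simp [projHeight]

/-- `h(x)` as a finite sum over any finite set of places containing the support of
`q ↦ ord_q(x)`. [cite: RoyWaldschmidt1997ENS, §4, p. 772] -/
theorem projHeight_eq_sum (x : ι → K) (T : Finset (PlaceOver k K))
    (hT : ∀ q : PlaceOver k K, ordVec q x ≠ 0 → q ∈ T) :
    projHeight k x = ∑ q ∈ T, -(ordVec q x * (q.degree : ℤ)) := by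
  unfold projHeight
  apply finsum_eq_sum_of_support_subset
  intro q hq
  rw [Function.mem_support] at hq
  exact Finset.mem_coe.2 (hT q fun h ↦ hq (by simp [h]))

/-- A finite set of places adapted to finitely many tuples and elements: it contains every place
at which one of them has nonzero order. [folklore] -/
theorem exists_finset_places [IsAlgFunctionField k K] (xs : Finset (ι → K)) (as : Finset K) :
    ∃ T : Finset (PlaceOver k K), (∀ x ∈ xs, ∀ q, ordVec q x ≠ 0 → q ∈ T) ∧
      (∀ a ∈ as, a ≠ 0 → ∀ q : PlaceOver k K, q.ord a ≠ 0 → q ∈ T) := by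
  have h1 : (⋃ x ∈ xs, {q : PlaceOver k K | ordVec q x ≠ 0}).Finite :=
    xs.finite_toSet.biUnion fun x _ ↦ finite_setOf_ordVec_ne_zero x
  have h2 : (⋃ a ∈ as.filter (· ≠ 0), {q : PlaceOver k K | q.ord a ≠ 0}).Finite :=
    (as.filter (· ≠ 0)).finite_toSet.biUnion fun a ha ↦
      finite_setOf_ord_ne_zero_of_ne_zero (K := k) (Finset.mem_filter.1 ha).2
  refine ⟨(h1.union h2).toFinset, fun x hx q hq ↦ ?_, fun a ha ha0 q hq ↦ ?_⟩
  · simp only [Set.Finite.mem_toFinset, Set.mem_union, Set.mem_iUnion, Set.mem_setOf_eq]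
    exact Or.inl ⟨x, hx, hq⟩
  · simp only [Set.Finite.mem_toFinset, Set.mem_union, Set.mem_iUnion, Set.mem_setOf_eq,
      Finset.mem_filter]
    exact Or.inr ⟨a, ⟨ha, ha0⟩, hq⟩

/-- **Projective invariance**: `h(c x) = h(x)` for `c ∈ Kˣ` — the product formula
`∑_q ord_q(c) deg q = 0`. [cite: RoyWaldschmidt1997ENS, §4, p. 772] -/
theorem projHeight_smul [IsAlgFunctionField k K] (x : ι → K) {c : K} (hc : c ≠ 0) :
    projHeight k (c • x) = projHeight k x := by
  by_cases hx : x = 0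
  · simp [hx]
  obtain ⟨T, hT, hTa⟩ := exists_finset_places (k := k) {x, c • x} {c}
  rw [projHeight_eq_sum x T (hT x (by simp)), projHeight_eq_sum (c • x) T (hT _ (by simp))]
  have hpf := sum_ord_mul_degree_eq_zero hc T (hTa c (by simp) hc)
  simp only [ordVec_smul _ hx hc, add_mul, neg_add, Finset.sum_add_distrib, Finset.sum_neg_distrib]
  rw [hpf, neg_zero, zero_add]

/-- **`h(x) ≥ 0`**: for a nonzero coordinate `xᵢ`, `ord_q(x) ≤ ord_q(xᵢ)` at every place and
`∑_q ord_q(xᵢ) deg q = 0`. [cite: RoyWaldschmidt1997ENS, §4, p. 772] -/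
theorem projHeight_nonneg [IsAlgFunctionField k K] (x : ι → K) : 0 ≤ projHeight k x := by
  by_cases hx : x = 0
  · simp [hx]
  obtain ⟨i, hi⟩ := Function.ne_iff.1 hx
  obtain ⟨T, hT, hTa⟩ := exists_finset_places (k := k) {x} {x i}
  rw [projHeight_eq_sum x T (hT x (by simp)), ← neg_zero,
    ← sum_ord_mul_degree_eq_zero hi T (hTa _ (by simp) hi), ← Finset.sum_neg_distrib]
  refine Finset.sum_le_sum fun q _ ↦ neg_le_neg ?_
  exact mul_le_mul_of_nonneg_right (ordVec_le q hi) (Nat.cast_nonneg _)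

/-- A tuple of constants has order `0` at every place (`ord_q(a) = 0` for `0 ≠ a` algebraic
over `k`, Stichtenoth Prop. 1.1.5 (c)). [cite: RoyWaldschmidt1997ENS, §4, p. 773] -/
theorem ordVec_eq_zero_of_isAlgebraic [IsAlgFunctionField k K] (q : PlaceOver k K) {x : ι → K}
    (hx : ∀ i, IsAlgebraic k (x i)) : ordVec q x = 0 := by
  by_cases hx0 : x = 0
  · rw [hx0, ordVec_zero]
  obtain ⟨i, hi, h⟩ := exists_ordVec_eq q hx0
  rw [h, q.ord_eq_zero_of_isAlgebraic hi (hx i)]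

/-- **Points defined over the constants have height `0`** ("pour tout sous-espace `V` de `Kⁿ`
défini sur `ℚ`, on a `h(V) = 0`", p. 773, rests on this): if all coordinates are algebraic over
`k` then `h(x) = 0`, and hence `h(c x) = 0` for `c ∈ Kˣ`. [cite: RoyWaldschmidt1997ENS, §4, p. 773] -/
theorem projHeight_eq_zero_of_isAlgebraic [IsAlgFunctionField k K] {x : ι → K}
    (hx : ∀ i, IsAlgebraic k (x i)) : projHeight k x = 0 := by
  rw [projHeight_eq_sum x ∅ fun q hq ↦ (hq (ordVec_eq_zero_of_isAlgebraic q hx)).elim]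
  simp

/-- `h(c x) = 0` for `c ∈ Kˣ` and `x` with algebraic coordinates (a point defined over the
constants, up to a scalar). [cite: RoyWaldschmidt1997ENS, §4, p. 773] -/
theorem projHeight_smul_eq_zero_of_isAlgebraic [IsAlgFunctionField k K] {x : ι → K}
    (hx : ∀ i, IsAlgebraic k (x i)) {c : K} (hc : c ≠ 0) : projHeight k (c • x) = 0 := by
  rw [projHeight_smul x hc, projHeight_eq_zero_of_isAlgebraic hx]

/-- In particular `h(x) = 0` for `x ∈ kⁿ⁺¹` (the image of the constant field).
[cite: RoyWaldschmidt1997ENS, §4, p. 773] -/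
theorem projHeight_algebraMap [IsAlgFunctionField k K] (y : ι → k) :
    projHeight k (fun i ↦ algebraMap k K (y i)) = 0 :=
  projHeight_eq_zero_of_isAlgebraic fun i ↦ isAlgebraic_algebraMap (y i)

/-! ### The affine height `h₁` -/

variable (k) in
/-- **The affine height** `h₁(x₁, …, xₙ) = h(1 : x₁ : … : xₙ) = ∑_q max{0, -ord_q(x)} deg q`
("le degré du ppcm des diviseurs des pôles de `x₁, …, xₙ`"), written directly as a `finsum` of
nonnegative terms; `affHeight_eq_projHeight` identifies it with `h(1 : x)`.
[cite: RoyWaldschmidt1997ENS, §4, p. 772] -/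
def affHeight (x : ι → K) : ℤ :=
  ∑ᶠ q : PlaceOver k K, max 0 (-ordVec q x) * (q.degree : ℤ)

/-- `h₁(0) = 0`. [cite: RoyWaldschmidt1997ENS, §4, p. 772] -/
@[simp]
theorem affHeight_zero : affHeight k (0 : ι → K) = 0 := by
  simp [affHeight]

/-- `h₁(x)` as a finite sum over any finite set of places containing the support of
`q ↦ ord_q(x)`. [cite: RoyWaldschmidt1997ENS, §4, p. 772] -/
theorem affHeight_eq_sum (x : ι → K) (T : Finset (PlaceOver k K))
    (hT : ∀ q : PlaceOver k K, ordVec q x ≠ 0 → q ∈ T) :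
    affHeight k x = ∑ q ∈ T, max 0 (-ordVec q x) * (q.degree : ℤ) := by
  unfold affHeight
  apply finsum_eq_sum_of_support_subset
  intro q hq
  rw [Function.mem_support] at hq
  exact Finset.mem_coe.2 (hT q fun h ↦ hq (by simp [h]))

/-- `h₁(x) ≥ 0`. [cite: RoyWaldschmidt1997ENS, §4, p. 772] -/
theorem affHeight_nonneg [IsAlgFunctionField k K] (x : ι → K) : 0 ≤ affHeight k x := by
  obtain ⟨T, hT, -⟩ := exists_finset_places (k := k) {x} ∅
  rw [affHeight_eq_sum x T (hT x (by simp))]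
  exact Finset.sum_nonneg fun q _ ↦ mul_nonneg (le_max_left _ _) (Nat.cast_nonneg _)

/-- Each local term is bounded by the height: `max{0, -ord_p(x)} · deg p ≤ h₁(x)`.
[cite: RoyWaldschmidt1997ENS, §4, p. 773] -/
theorem posPart_neg_ordVec_mul_degree_le_affHeight [IsAlgFunctionField k K] (x : ι → K)
    (p : PlaceOver k K) : max 0 (-ordVec p x) * (p.degree : ℤ) ≤ affHeight k x := by
  obtain ⟨T, hT, -⟩ := exists_finset_places (k := k) {x} ∅
  rw [affHeight_eq_sum x (insert p T) fun q hq ↦ Finset.mem_insert_of_mem (hT x (by simp) q hq)]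
  exact Finset.single_le_sum (f := fun q ↦ max 0 (-ordVec q x) * (q.degree : ℤ))
    (fun q _ ↦ mul_nonneg (le_max_left _ _) (Nat.cast_nonneg _)) (Finset.mem_insert_self p T)

/-- The order at `q` of the tuple `(1 : x)` is `min{0, ord_q(x)}`; more generally prefixing a
coordinate `a ≠ 0`: `ord_q((a : x)) = min{ord_q(a), ord_q(x)}` for `x ≠ 0`. [folklore] -/
theorem ordVec_cons {n : ℕ} (q : PlaceOver k K) {a : K} (ha : a ≠ 0) {x : Fin n → K}
    (hx : x ≠ 0) : ordVec q (Fin.cons a x : Fin (n + 1) → K) = min (q.ord a) (ordVec q x) := by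
  set y : Fin (n + 1) → K := Fin.cons a x with hy
  have hy0 : y 0 = a := by simp [hy]
  have hys : ∀ j : Fin n, y j.succ = x j := fun j ↦ by simp [hy]
  have hc : y ≠ 0 := fun h ↦ ha (by rw [← hy0, h]; rfl)
  refine le_antisymm ?_ ?_
  · refine le_min ?_ ?_
    · have h := ordVec_le q (x := y) (i := 0) (by rw [hy0]; exact ha)
      rwa [hy0] at h
    · obtain ⟨i, hi, h⟩ := exists_ordVec_eq q hx
      rw [h]
      have h' := ordVec_le q (x := y) (i := i.succ) (by rw [hys]; exact hi)
      rwa [hys] at h'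
  · rw [le_ordVec_iff q hc]
    intro i hi
    rcases Fin.eq_zero_or_eq_succ i with rfl | ⟨j, rfl⟩
    · rw [hy0]
      exact min_le_left _ _
    · rw [hys] at hi ⊢
      exact (min_le_right _ _).trans (ordVec_le q hi)

/-- `ord_q((1 : x)) = min{0, ord_q(x)}`. [cite: RoyWaldschmidt1997ENS, §4, p. 772] -/
theorem ordVec_cons_one {n : ℕ} (q : PlaceOver k K) (x : Fin n → K) :
    ordVec q (Fin.cons 1 x : Fin (n + 1) → K) = min 0 (ordVec q x) := by
  by_cases hx : x = 0
  · subst hx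
    set y : Fin (n + 1) → K := Fin.cons 1 0 with hy
    have hy0 : y 0 = 1 := by simp [hy]
    have hys : ∀ j : Fin n, y j.succ = 0 := fun j ↦ by simp [hy]
    rw [ordVec_zero, min_eq_right le_rfl]
    refine le_antisymm ?_ ?_
    · have h := ordVec_le q (x := y) (i := 0) (by rw [hy0]; exact one_ne_zero)
      rwa [hy0, q.ord_one] at h
    · rw [le_ordVec_iff q (fun h ↦ one_ne_zero (by rw [← hy0, h]; rfl))]
      intro i hi
      rcases Fin.eq_zero_or_eq_succ i with rfl | ⟨j, rfl⟩
      · rw [hy0, q.ord_one]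
      · exact (hi (hys j)).elim
  · rw [ordVec_cons q one_ne_zero hx, q.ord_one]

/-- **`h₁(x) = h(1 : x)`.** [cite: RoyWaldschmidt1997ENS, §4, p. 772] -/
theorem affHeight_eq_projHeight [IsAlgFunctionField k K] {n : ℕ} (x : Fin n → K) :
    affHeight k x = projHeight k (Fin.cons 1 x : Fin (n + 1) → K) := by
  obtain ⟨T, hT, -⟩ := exists_finset_places (k := k) {x} ∅
  have hT' : ∀ q : PlaceOver k K, ordVec q (Fin.cons 1 x : Fin (n + 1) → K) ≠ 0 → q ∈ T := by
    intro q hq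
    rw [ordVec_cons_one] at hq
    exact hT x (by simp) q fun h ↦ hq (by simp [h])
  rw [affHeight_eq_sum x T (hT x (by simp)), projHeight_eq_sum _ T hT']
  refine Finset.sum_congr rfl fun q _ ↦ ?_
  rw [ordVec_cons_one, ← neg_mul]
  congr 1
  rcases le_total 0 (ordVec q x) with h | h
  · rw [min_eq_left h, max_eq_left (neg_nonpos.2 h), neg_zero]
  · rw [min_eq_right h, max_eq_right (neg_nonneg.2 h)]

/-- The affine height of a tuple of constants vanishes. [cite: RoyWaldschmidt1997ENS, §4, p. 773] -/
theorem affHeight_eq_zero_of_isAlgebraic [IsAlgFunctionField k K] {x : ι → K}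
    (hx : ∀ i, IsAlgebraic k (x i)) : affHeight k x = 0 := by
  rw [affHeight_eq_sum x ∅ fun q hq ↦ (hq (ordVec_eq_zero_of_isAlgebraic q hx)).elim]
  simp

/-- Constants (elements algebraic over `k`) have height `0`. [cite: RoyWaldschmidt1997ENS, §4, p. 773] -/
theorem affHeight_vecSingle_eq_zero_of_isAlgebraic [IsAlgFunctionField k K] {c : K}
    (hc : IsAlgebraic k c) : affHeight k ![c] = 0 :=
  affHeight_eq_zero_of_isAlgebraic (x := ![c]) fun i ↦ by rw [Matrix.cons_val_fin_one]; exact hc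

/-- `h₁(1) = 0`. [cite: RoyWaldschmidt1997ENS, §4, p. 773] -/
@[simp]
theorem affHeight_one [IsAlgFunctionField k K] : affHeight k ![(1 : K)] = 0 :=
  affHeight_vecSingle_eq_zero_of_isAlgebraic isAlgebraic_one

/-- `h₁(0) = 0` (single element). [cite: RoyWaldschmidt1997ENS, §4, p. 773] -/
@[simp]
theorem affHeight_vecSingle_zero [IsAlgFunctionField k K] : affHeight k ![(0 : K)] = 0 :=
  affHeight_vecSingle_eq_zero_of_isAlgebraic isAlgebraic_zero

/-! ### Comparison principles: heights are controlled place by place -/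

/-- If `min{0, ord_q(x)} ≤ min{0, ord_q(y)}` at every place, then `h₁(y) ≤ h₁(x)`. [folklore] -/
theorem affHeight_le_of_forall [IsAlgFunctionField k K] {ι' : Type*} [Fintype ι'] {x : ι → K}
    {y : ι' → K} (h : ∀ q : PlaceOver k K, min 0 (ordVec q x) ≤ min 0 (ordVec q y)) :
    affHeight k y ≤ affHeight k x := by
  obtain ⟨T, hT, -⟩ := exists_finset_places (k := k) {x} ∅
  obtain ⟨T', hT', -⟩ := exists_finset_places (k := k) {y} ∅
  rw [affHeight_eq_sum x (T ∪ T') fun q hq ↦ Finset.mem_union_left _ (hT x (by simp) q hq),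
    affHeight_eq_sum y (T ∪ T') fun q hq ↦ Finset.mem_union_right _ (hT' y (by simp) q hq)]
  refine Finset.sum_le_sum fun q _ ↦ mul_le_mul_of_nonneg_right ?_ (Nat.cast_nonneg _)
  have := h q
  simp only [max_le_iff, le_max_iff]
  omega

/-- If `min{0, ord_q(x)} + min{0, ord_q(y)} ≤ min{0, ord_q(z)}` at every place, then
`h₁(z) ≤ h₁(x) + h₁(y)`. [folklore] -/
theorem affHeight_le_add_of_forall [IsAlgFunctionField k K] {ι₁ ι₂ : Type*} [Fintype ι₁]
    [Fintype ι₂] {x : ι₁ → K} {y : ι₂ → K} {z : ι → K}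
    (h : ∀ q : PlaceOver k K, min 0 (ordVec q x) + min 0 (ordVec q y) ≤ min 0 (ordVec q z)) :
    affHeight k z ≤ affHeight k x + affHeight k y := by
  obtain ⟨Tx, hTx, -⟩ := exists_finset_places (k := k) {x} ∅
  obtain ⟨Ty, hTy, -⟩ := exists_finset_places (k := k) {y} ∅
  obtain ⟨Tz, hTz, -⟩ := exists_finset_places (k := k) {z} ∅
  set T := Tx ∪ Ty ∪ Tz with hTdef
  rw [affHeight_eq_sum x T fun q hq ↦ by simp [hTdef, hTx x (by simp) q hq],
    affHeight_eq_sum y T fun q hq ↦ by simp [hTdef, hTy y (by simp) q hq],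
    affHeight_eq_sum z T fun q hq ↦ by simp [hTdef, hTz z (by simp) q hq],
    ← Finset.sum_add_distrib]
  refine Finset.sum_le_sum fun q _ ↦ ?_
  rw [← add_mul]
  refine mul_le_mul_of_nonneg_right ?_ (Nat.cast_nonneg _)
  have := h q
  simp only [max_le_iff]
  constructor
  · exact add_nonneg (le_max_left _ _) (le_max_left _ _)
  · have h1 : -min 0 (ordVec q x) ≤ max 0 (-ordVec q x) := by
      simp only [le_max_iff]; omega
    have h2 : -min 0 (ordVec q y) ≤ max 0 (-ordVec q y) := by
      simp only [le_max_iff]; omega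
    omega

/-- If `∑ⱼ min{0, ord_q(xⱼ)} ≤ min{0, ord_q(z)}` at every place, then `h₁(z) ≤ ∑ⱼ h₁(xⱼ)`.
[folklore] -/
theorem affHeight_le_sum_of_forall [IsAlgFunctionField k K] {J : Type*} (s : Finset J)
    {ι' : Type*} [Fintype ι'] {x : J → ι' → K} {z : ι → K}
    (h : ∀ q : PlaceOver k K, ∑ j ∈ s, min 0 (ordVec q (x j)) ≤ min 0 (ordVec q z)) :
    affHeight k z ≤ ∑ j ∈ s, affHeight k (x j) := by
  -- a common finite set of places
  obtain ⟨Tz, hTz, -⟩ := exists_finset_places (k := k) {z} ∅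
  obtain ⟨Tx, hTx, -⟩ := exists_finset_places (k := k) (s.image x) ∅
  have hxT : ∀ j ∈ s, ∀ q, ordVec q (x j) ≠ 0 → q ∈ Tz ∪ Tx := fun j hj q hq ↦
    Finset.mem_union_right _ (hTx (x j) (Finset.mem_image_of_mem x hj) q hq)
  rw [affHeight_eq_sum z (Tz ∪ Tx) fun q hq ↦ Finset.mem_union_left _ (hTz z (by simp) q hq)]
  rw [Finset.sum_congr rfl fun j hj ↦ affHeight_eq_sum (x j) _ (hxT j hj), Finset.sum_comm]
  refine Finset.sum_le_sum fun q _ ↦ ?_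
  rw [← Finset.sum_mul]
  refine mul_le_mul_of_nonneg_right ?_ (Nat.cast_nonneg _)
  have hq := h q
  have hterm : ∀ j ∈ s, -min 0 (ordVec q (x j)) ≤ max 0 (-ordVec q (x j)) := fun j _ ↦ by
    simp only [le_max_iff]; omega
  have hsum := Finset.sum_le_sum hterm
  rw [Finset.sum_neg_distrib] at hsum
  simp only [max_le_iff]
  refine ⟨Finset.sum_nonneg fun j _ ↦ le_max_left _ _, ?_⟩
  have h3 : -min 0 (ordVec q z) ≤ -∑ j ∈ s, min 0 (ordVec q (x j)) := neg_le_neg hq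
  have h4 : -ordVec q z ≤ -min 0 (ordVec q z) := neg_le_neg (min_le_right _ _)
  exact h4.trans (h3.trans hsum)

/-! ### Consequences: the height of sub-tuples, products, sums, powers, inverses -/

/-- `min{0, ord_q(x)} ≤ min{0, ord_q(xᵢ)}`: a coordinate is controlled by the tuple. [folklore] -/
theorem min_ordVec_le_min_ord (q : PlaceOver k K) (x : ι → K) (i : ι) :
    min 0 (ordVec q x) ≤ min 0 (q.ord (x i)) := by
  by_cases hi : x i = 0
  · rw [hi, ord_zero_eq, min_self]
    exact min_le_left _ _
  · have := ordVec_le q hi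
    simp only [le_min_iff, min_le_iff]
    exact ⟨Or.inl le_rfl, Or.inr this⟩

/-- `h₁(xᵢ) ≤ h₁(x)`: the height of a coordinate is at most the height of the tuple.
[cite: RoyWaldschmidt1997ENS, §4, p. 772] -/
theorem affHeight_apply_le [IsAlgFunctionField k K] (x : ι → K) (i : ι) :
    affHeight k ![x i] ≤ affHeight k x :=
  affHeight_le_of_forall fun q ↦ by simpa using min_ordVec_le_min_ord q x i

/-- More generally the height of a sub-tuple (reindexing along any map) is at most the height of
the tuple. [cite: RoyWaldschmidt1997ENS, §4, p. 772] -/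
theorem affHeight_comp_le [IsAlgFunctionField k K] {ι' : Type*} [Fintype ι'] (x : ι → K)
    (f : ι' → ι) : affHeight k (x ∘ f) ≤ affHeight k x := by
  refine affHeight_le_of_forall fun q ↦ ?_
  by_cases h0 : x ∘ f = 0
  · rw [h0, ordVec_zero]; exact min_le_left _ _
  · simp only [le_min_iff, min_le_iff]
    refine ⟨Or.inl le_rfl, Or.inr ?_⟩
    rw [le_ordVec_iff q h0]
    exact fun j hj ↦ ordVec_le q (x := x) (i := f j) hj

/-- `h₁(x) ≤ ∑ᵢ h₁(xᵢ)` ("le degré du ppcm des diviseurs des pôles" is at most the sum of the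
degrees of the pole divisors). [cite: RoyWaldschmidt1997ENS, §4, p. 772] -/
theorem affHeight_le_sum_apply [IsAlgFunctionField k K] (x : ι → K) :
    affHeight k x ≤ ∑ i, affHeight k ![x i] := by
  refine affHeight_le_sum_of_forall Finset.univ fun q ↦ ?_
  simp only [ordVec_vecSingle]
  by_cases hx : x = 0
  · rw [hx, ordVec_zero, min_self]
    exact Finset.sum_nonpos fun i _ ↦ min_le_left _ _
  · obtain ⟨i, hi, h⟩ := exists_ordVec_eq q hx
    rw [h]
    rw [← Finset.add_sum_erase _ _ (Finset.mem_univ i)]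
    have := Finset.sum_nonpos (s := Finset.univ.erase i) (f := fun j ↦ min 0 (q.ord (x j)))
      fun j _ ↦ min_le_left _ _
    linarith

/-- **`h₁(a b) ≤ h₁(a) + h₁(b)`** (`ord_q(ab) = ord_q(a) + ord_q(b)`).
[cite: RoyWaldschmidt1997ENS, §4, p. 772] -/
theorem affHeight_mul_le [IsAlgFunctionField k K] (a b : K) :
    affHeight k ![a * b] ≤ affHeight k ![a] + affHeight k ![b] := by
  refine affHeight_le_add_of_forall fun q ↦ ?_
  simp only [ordVec_vecSingle]
  have h0 : min 0 (q.ord a) + min 0 (q.ord b) ≤ 0 := add_nonpos (min_le_left _ _) (min_le_left _ _)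
  by_cases hab : a * b = 0
  · rw [hab, ord_zero_eq, min_self]; exact h0
  rw [q.ord_mul_eq (left_ne_zero_of_mul hab) (right_ne_zero_of_mul hab)]
  exact le_min h0 (add_le_add (min_le_right _ _) (min_le_right _ _))

/-- `h₁(∏ⱼ aⱼ) ≤ ∑ⱼ h₁(aⱼ)`. [cite: RoyWaldschmidt1997ENS, §4, p. 772] -/
theorem affHeight_prod_le [IsAlgFunctionField k K] {J : Type*} (s : Finset J) (a : J → K) :
    affHeight k ![∏ j ∈ s, a j] ≤ ∑ j ∈ s, affHeight k ![a j] := by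
  induction s using Finset.induction_on with
  | empty =>
    simp only [Finset.prod_empty, Finset.sum_empty]
    rw [affHeight_one]
  | insert j s hj ih =>
    rw [Finset.prod_insert hj, Finset.sum_insert hj]
    exact (affHeight_mul_le _ _).trans (add_le_add le_rfl ih)

/-- `h₁(aⁿ) ≤ n h₁(a)`. [cite: RoyWaldschmidt1997ENS, §4, p. 772] -/
theorem affHeight_pow_le [IsAlgFunctionField k K] (a : K) (n : ℕ) :
    affHeight k ![a ^ n] ≤ n * affHeight k ![a] := by
  have := affHeight_prod_le (k := k) (Finset.range n) (fun _ ↦ a)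
  simpa using this

/-- **`h₁(a⁻¹) = h₁(a)`** for `a ≠ 0`: "le degré commun des diviseurs des pôles et des zéros"
(product formula). [cite: RoyWaldschmidt1997ENS, §4, p. 773] -/
theorem sum_posPart_ord_eq_sum_negPart_ord [IsAlgFunctionField k K] {a : K} (ha : a ≠ 0)
    (T : Finset (PlaceOver k K)) (hT : ∀ q : PlaceOver k K, q.ord a ≠ 0 → q ∈ T) :
    ∑ q ∈ T, max 0 (q.ord a) * (q.degree : ℤ) = ∑ q ∈ T, max 0 (-q.ord a) * (q.degree : ℤ) := by
  have h0 := sum_ord_mul_degree_eq_zero ha T hT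
  rw [← sub_eq_zero, ← Finset.sum_sub_distrib]
  refine Eq.trans (Finset.sum_congr rfl fun q _ ↦ ?_) h0
  rw [← sub_mul]
  congr 1
  rcases le_total 0 (q.ord a) with h | h
  · rw [max_eq_right h, max_eq_left (by omega)]; ring
  · rw [max_eq_left h, max_eq_right (by omega)]; ring

/-- `h₁(a)` is the degree of the divisor of zeros of `a ≠ 0`: `h₁(a) = ∑_q max{0, ord_q(a)} deg q`.
[cite: RoyWaldschmidt1997ENS, §4, p. 773] -/
theorem affHeight_eq_sum_posPart [IsAlgFunctionField k K] {a : K} (ha : a ≠ 0)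
    (T : Finset (PlaceOver k K)) (hT : ∀ q : PlaceOver k K, q.ord a ≠ 0 → q ∈ T) :
    affHeight k ![a] = ∑ q ∈ T, max 0 (q.ord a) * (q.degree : ℤ) := by
  rw [sum_posPart_ord_eq_sum_negPart_ord ha T hT,
    affHeight_eq_sum _ T fun q hq ↦ hT q (by simpa using hq)]
  simp

/-- **`h₁(a⁻¹) = h₁(a)`**: "le degré commun des diviseurs des pôles et des zéros de `x`".
[cite: RoyWaldschmidt1997ENS, §4, p. 773] -/
theorem affHeight_inv [IsAlgFunctionField k K] (a : K) : affHeight k ![a⁻¹] = affHeight k ![a] := by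
  by_cases ha : a = 0
  · simp [ha]
  obtain ⟨T, -, hTa⟩ := exists_finset_places (k := k) (ι := Fin 1) ∅ {a, a⁻¹}
  rw [affHeight_eq_sum _ T fun q hq ↦ hTa a⁻¹ (by simp) (inv_ne_zero ha) q (by simpa using hq),
    affHeight_eq_sum_posPart ha T (hTa a (by simp) ha)]
  refine Finset.sum_congr rfl fun q _ ↦ ?_
  rw [ordVec_vecSingle, q.ord_inv ha, neg_neg]

/-- `h₁(aⁿ) ≤ |n| h₁(a)` for `n ∈ ℤ`. [cite: RoyWaldschmidt1997ENS, §4, p. 773] -/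
theorem affHeight_zpow_le [IsAlgFunctionField k K] (a : K) (n : ℤ) :
    affHeight k ![a ^ n] ≤ |n| * affHeight k ![a] := by
  obtain ⟨m, rfl | rfl⟩ := n.eq_nat_or_neg
  · simpa using affHeight_pow_le (k := k) a m
  · rw [zpow_neg, zpow_natCast, ← inv_pow, abs_neg, Nat.abs_cast]
    exact (affHeight_pow_le _ m).trans (by rw [affHeight_inv])

/-- A monomial: `h₁(∏ⱼ aⱼ ^ nⱼ) ≤ ∑ⱼ |nⱼ| h₁(aⱼ)` (the shape `π₁(γ)^φ` of step 2 of the proof of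
Théorème 4.1, p. 777). [cite: RoyWaldschmidt1997ENS, §4, p. 777] -/
theorem affHeight_prod_zpow_le [IsAlgFunctionField k K] {J : Type*} (s : Finset J) (a : J → K)
    (n : J → ℤ) : affHeight k ![∏ j ∈ s, a j ^ n j] ≤ ∑ j ∈ s, |n j| * affHeight k ![a j] :=
  (affHeight_prod_le s _).trans (Finset.sum_le_sum fun _ _ ↦ affHeight_zpow_le _ _)

/-- The two-coordinate tuple controls the sum: `min{0, ord_q(a), ord_q(b)} ≤ min{0, ord_q(a+b)}`.
[folklore] -/
theorem min_ord_ord_le_min_ord_add (q : PlaceOver k K) (a b : K) :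
    min 0 (min (q.ord a) (q.ord b)) ≤ min 0 (q.ord (a + b)) := by
  by_cases ha : a = 0
  · rw [ha, zero_add]
    exact min_le_min le_rfl (min_le_right _ _)
  by_cases hb : b = 0
  · rw [hb, add_zero]
    exact min_le_min le_rfl (min_le_left _ _)
  by_cases hab : a + b = 0
  · rw [hab, ord_zero_eq, min_self]
    exact min_le_left _ _
  exact min_le_min le_rfl (PlaceOver.min_ord_le_ord_add_holds q ha hb hab)

/-- **`h₁(a + b) ≤ h₁(a) + h₁(b)`** (no archimedean places: `ord_q(a+b) ≥ min{ord_q a, ord_q b}`).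
[cite: RoyWaldschmidt1997ENS, §4, p. 772] -/
theorem affHeight_add_le [IsAlgFunctionField k K] (a b : K) :
    affHeight k ![a + b] ≤ affHeight k ![a] + affHeight k ![b] := by
  refine affHeight_le_add_of_forall fun q ↦ ?_
  simp only [ordVec_vecSingle]
  refine le_trans ?_ (min_ord_ord_le_min_ord_add q a b)
  have h1 := min_le_left 0 (q.ord a)
  have h2 := min_le_right 0 (q.ord a)
  have h3 := min_le_left 0 (q.ord b)
  have h4 := min_le_right 0 (q.ord b)
  simp only [le_min_iff]
  exact ⟨by linarith, by linarith, by linarith⟩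

/-- `h₁(-a) = h₁(a)`. [cite: RoyWaldschmidt1997ENS, §4, p. 772] -/
theorem affHeight_neg [IsAlgFunctionField k K] (a : K) : affHeight k ![-a] = affHeight k ![a] := by
  refine le_antisymm (affHeight_le_of_forall fun q ↦ ?_) (affHeight_le_of_forall fun q ↦ ?_) <;>
    simp [q.ord_neg]

/-- `h₁(a - b) ≤ h₁(a) + h₁(b)`. [cite: RoyWaldschmidt1997ENS, §4, p. 772] -/
theorem affHeight_sub_le [IsAlgFunctionField k K] (a b : K) :
    affHeight k ![a - b] ≤ affHeight k ![a] + affHeight k ![b] := by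
  rw [sub_eq_add_neg, ← affHeight_neg b]
  exact affHeight_add_le a (-b)

/-- Adding a constant does not raise the height: `h₁(a + c) ≤ h₁(a)` for `c` algebraic over `k`
(in particular `h₁(a - 1) ≤ h₁(a)`, the shape `π₁(γ)^φ - 1` of step 2 of the proof of
Théorème 4.1). [cite: RoyWaldschmidt1997ENS, §4, p. 777] -/
theorem affHeight_add_const_le [IsAlgFunctionField k K] (a : K) {c : K} (hc : IsAlgebraic k c) :
    affHeight k ![a + c] ≤ affHeight k ![a] := by
  refine (affHeight_add_le a c).trans ?_
  rw [affHeight_vecSingle_eq_zero_of_isAlgebraic hc, add_zero]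

/-- `h₁(a - 1) ≤ h₁(a)` (the shape `π₁(γ)^φ - 1` of step 2 of the proof of Théorème 4.1).
[cite: RoyWaldschmidt1997ENS, §4, p. 777] -/
theorem affHeight_sub_one_le [IsAlgFunctionField k K] (a : K) :
    affHeight k ![a - 1] ≤ affHeight k ![a] := by
  rw [sub_eq_add_neg]
  exact affHeight_add_const_le a (isAlgebraic_one.neg)

/-- `h₁(∑ⱼ aⱼ) ≤ ∑ⱼ h₁(aⱼ)`. [cite: RoyWaldschmidt1997ENS, §4, p. 772] -/
theorem affHeight_sum_le [IsAlgFunctionField k K] {J : Type*} (s : Finset J) (a : J → K) :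
    affHeight k ![∑ j ∈ s, a j] ≤ ∑ j ∈ s, affHeight k ![a j] := by
  induction s using Finset.induction_on with
  | empty =>
    simp only [Finset.sum_empty]
    rw [affHeight_vecSingle_zero]
  | insert j s hj ih =>
    rw [Finset.sum_insert hj, Finset.sum_insert hj]
    exact (affHeight_add_le _ _).trans (add_le_add le_rfl ih)

/-! ### Heights of minors (step 4 of the proof of Théorème 4.1) -/

/-- `ord_q(∏ⱼ yⱼ) = ∑ⱼ ord_q(yⱼ)` for nonzero `yⱼ`. [folklore] -/
theorem ord_prod_eq {J : Type*} (q : PlaceOver k K) (s : Finset J) {y : J → K}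
    (hy : ∀ j ∈ s, y j ≠ 0) : q.ord (∏ j ∈ s, y j) = ∑ j ∈ s, q.ord (y j) := by
  induction s using Finset.induction_on with
  | empty => simp [q.ord_one]
  | insert j s hj ih =>
    rw [Finset.prod_insert hj, Finset.sum_insert hj,
      q.ord_mul_eq (hy j (Finset.mem_insert_self j s))
        (Finset.prod_ne_zero_iff.2 fun i hi ↦ hy i (Finset.mem_insert_of_mem hi)),
      ih fun i hi ↦ hy i (Finset.mem_insert_of_mem hi)]

/-- Valuation of a determinant: `min{0, ord_q(det M)} ≥ ∑ⱼ min{0, ord_q(Mⱼ)}`, `Mⱼ` the `j`-th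
column. [folklore] -/
theorem sum_min_ordVec_col_le_min_ord_det {m : Type*} [Fintype m] [DecidableEq m]
    (q : PlaceOver k K) (M : Matrix m m K) :
    ∑ j, min 0 (ordVec q fun i ↦ M i j) ≤ min 0 (q.ord M.det) := by
  -- each column lies in `π_q^{c_j} 𝒪_q` with `c_j = min{0, ord_q(M_j)}`; pull the powers out
  set c : m → ℤ := fun j ↦ min 0 (ordVec q fun i ↦ M i j) with hc
  have hπ0 : (q.uniformizer : K) ≠ 0 := q.coe_uniformizer_ne_zero
  set y : m → K := fun j ↦ (q.uniformizer : K) ^ (-c j) with hy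
  have hy0 : ∀ j, y j ≠ 0 := fun j ↦ zpow_ne_zero _ hπ0
  have hyord : ∀ j, q.ord (y j) = -c j := fun j ↦ q.ord_uniformizer_zpow _
  -- entries of the rescaled matrix are integral at `q`
  have hint : ∀ i j, M i j * y j ∈ q.toValuationSubring := by
    intro i j
    by_cases hij : M i j = 0
    · rw [hij, zero_mul]; exact zero_mem _
    rw [q.mem_toValuationSubring_iff_ord_nonneg (mul_ne_zero hij (hy0 j)),
      q.ord_mul_eq hij (hy0 j), hyord]
    have h1 : c j ≤ q.ord (M i j) :=
      (min_le_right _ _).trans (ordVec_le q (x := fun i ↦ M i j) (i := i) hij)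
    omega
  set N : Matrix m m q.toValuationSubring := fun i j ↦ ⟨M i j * y j, hint i j⟩ with hN
  have hdetN : (N.det : K) = M.det * ∏ j, y j := by
    have h1 : (N.det : K) = (N.map (algebraMap q.toValuationSubring K)).det := by
      rw [show (N.det : K) = algebraMap q.toValuationSubring K N.det from rfl, RingHom.map_det,
        RingHom.mapMatrix_apply]
    have h2 : N.map (algebraMap q.toValuationSubring K) = fun i j ↦ M i j * y j := by
      ext i j; rfl
    have h3 : (fun i j ↦ M i j * y j) = M * Matrix.diagonal y := by
      ext i j; simp [Matrix.mul_diagonal]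
    rw [h1, h2, h3, Matrix.det_mul, Matrix.det_diagonal]
  have hmem : M.det * ∏ j, y j ∈ q.toValuationSubring := hdetN ▸ N.det.2
  have hsum0 : ∑ j, c j ≤ 0 := Finset.sum_nonpos fun j _ ↦ min_le_left _ _
  by_cases hdet : M.det = 0
  · rw [hdet, ord_zero_eq, min_self]
    exact hsum0
  have hprod : ∏ j, y j ≠ 0 := Finset.prod_ne_zero_iff.2 fun j _ ↦ hy0 j
  rw [q.mem_toValuationSubring_iff_ord_nonneg (mul_ne_zero hdet hprod),
    q.ord_mul_eq hdet hprod, ord_prod_eq q _ (fun j _ ↦ hy0 j)] at hmem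
  simp only [hyord, Finset.sum_neg_distrib] at hmem
  simp only [le_min_iff]
  refine ⟨hsum0, ?_⟩
  linarith

/-- **Heights of minors** (step 4 of the proof of Théorème 4.1, p. 777: "si `Δ` désigne un mineur
… on a `h₁(Δ) ≤ ∑ⱼ h₁(wⱼ)`"): the height of the determinant of a square matrix is at most the sum
of the heights of its columns. [cite: RoyWaldschmidt1997ENS, §4, p. 777] -/
theorem affHeight_det_le [IsAlgFunctionField k K] {m : Type*} [Fintype m] [DecidableEq m]
    (M : Matrix m m K) : affHeight k ![M.det] ≤ ∑ j, affHeight k (fun i ↦ M i j) :=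
  affHeight_le_sum_of_forall Finset.univ fun q ↦ by
    simpa using sum_min_ordVec_col_le_min_ord_det q M

/-- The same for a square minor of a rectangular matrix (columns `wⱼ`, `j ∈` the chosen column
set): `h₁(Δ) ≤ ∑_{chosen j} h₁(wⱼ) ≤ ∑_{all j} h₁(wⱼ)`. [cite: RoyWaldschmidt1997ENS, §4, p. 777] -/
theorem affHeight_det_submatrix_le [IsAlgFunctionField k K] {m d l : Type*} [Fintype m]
    [DecidableEq m] [Fintype d] [Fintype l] (M : Matrix d l K) (r : m → d) (e : m ↪ l) :
    affHeight k ![(M.submatrix r e).det] ≤ ∑ j, affHeight k (fun i ↦ M i j) := by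
  refine (affHeight_det_le _).trans ?_
  calc ∑ j, affHeight k (fun i ↦ (M.submatrix r e) i j)
      ≤ ∑ j, affHeight k (fun i ↦ M i (e j)) :=
        Finset.sum_le_sum fun j _ ↦ affHeight_comp_le (fun i ↦ M i (e j)) r
    _ = ∑ j ∈ Finset.univ.map e, affHeight k (fun i ↦ M i j) := by
        rw [Finset.sum_map]
    _ ≤ ∑ j, affHeight k (fun i ↦ M i j) :=
        Finset.sum_le_sum_of_subset_of_nonneg (Finset.subset_univ _)
          fun j _ _ ↦ affHeight_nonneg _

/-! ### Lemme 4.2 -/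

/-- **Roy–Waldschmidt, Lemme 4.2 (valuation form).** If `x ≠ 0` and `h₁(x) < deg 𝔭` then
`ord_𝔭(x) = 0`: otherwise `𝔭` divides the divisor of poles (resp. of zeros) of `x`, whose degree
is `h₁(x)`, forcing `h₁(x) ≥ deg 𝔭`. [cite: RoyWaldschmidt1997ENS, Lemme 4.2, p. 773] -/
theorem ord_eq_zero_of_affHeight_lt_degree [IsAlgFunctionField k K] (p : PlaceOver k K) {x : K}
    (hx : x ≠ 0) (h : affHeight k ![x] < p.degree) : p.ord x = 0 := by
  by_contra hne
  rcases lt_or_gt_of_ne hne with hlt | hgt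
  · -- `𝔭` is a pole
    have h1 := posPart_neg_ordVec_mul_degree_le_affHeight (k := k) ![x] p
    rw [ordVec_vecSingle] at h1
    have h2 : (p.degree : ℤ) ≤ max 0 (-p.ord x) * (p.degree : ℤ) := by
      have : (1 : ℤ) ≤ max 0 (-p.ord x) := le_max_of_le_right (by omega)
      nlinarith [Nat.cast_nonneg (α := ℤ) p.degree]
    omega
  · -- `𝔭` is a zero: use `h₁(x) = deg (x)₀`
    obtain ⟨T, -, hTa⟩ := exists_finset_places (k := k) (ι := Fin 1) ∅ {x}
    have hT := hTa x (by simp) hx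
    rw [affHeight_eq_sum_posPart hx (insert p T) fun q hq ↦ Finset.mem_insert_of_mem (hT q hq)] at h
    have h1 : max 0 (p.ord x) * (p.degree : ℤ) ≤
        ∑ q ∈ insert p T, max 0 (q.ord x) * (q.degree : ℤ) :=
      Finset.single_le_sum (f := fun q ↦ max 0 (q.ord x) * (q.degree : ℤ))
        (fun q _ ↦ mul_nonneg (le_max_left _ _) (Nat.cast_nonneg _)) (Finset.mem_insert_self p T)
    have h2 : (p.degree : ℤ) ≤ max 0 (p.ord x) * (p.degree : ℤ) := by
      have : (1 : ℤ) ≤ max 0 (p.ord x) := le_max_of_le_right (by omega)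
      nlinarith [Nat.cast_nonneg (α := ℤ) p.degree]
    omega

/-- **Roy–Waldschmidt, Lemme 4.2.** "Soit `x` un élément non nul de `K`. Si `h₁(x) < D`, alors on a
`x ∈ 𝒪` et `x̄ ≠ 0`": `x` lies in the valuation ring of the place `𝔭` of degree `D` and is a unit
there, i.e. its reduction `x̄` in the residue field is nonzero.
[cite: RoyWaldschmidt1997ENS, Lemme 4.2, p. 773] -/
theorem lemme_4_2 [IsAlgFunctionField k K] (p : PlaceOver k K) {x : K} (hx : x ≠ 0)
    (h : affHeight k ![x] < p.degree) :
    ∃ hmem : x ∈ p.toValuationSubring,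
      IsLocalRing.residue p.toValuationSubring ⟨x, hmem⟩ ≠ 0 := by
  have h0 := ord_eq_zero_of_affHeight_lt_degree p hx h
  have hmem : x ∈ p.toValuationSubring := by
    rw [p.mem_toValuationSubring_iff_ord_nonneg hx, h0]
  have hmem' : x⁻¹ ∈ p.toValuationSubring := by
    rw [p.mem_toValuationSubring_iff_ord_nonneg (inv_ne_zero hx), p.ord_inv hx, h0, neg_zero]
  refine ⟨hmem, ?_⟩
  rw [Ne, IsLocalRing.residue_eq_zero_iff]
  have hu : IsUnit (⟨x, hmem⟩ : p.toValuationSubring) :=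
    IsUnit.of_mul_eq_one ⟨x⁻¹, hmem'⟩ (Subtype.ext (by simp [hx]))
  exact fun hm ↦ (IsLocalRing.mem_maximalIdeal _ |>.1 hm) hu

/-- Lemme 4.2, unit form: `x` is a unit of `𝒪_𝔭`. [cite: RoyWaldschmidt1997ENS, Lemme 4.2, p. 773] -/
theorem isUnit_of_affHeight_lt_degree [IsAlgFunctionField k K] (p : PlaceOver k K) {x : K}
    (hx : x ≠ 0) (h : affHeight k ![x] < p.degree) :
    ∃ hmem : x ∈ p.toValuationSubring, IsUnit (⟨x, hmem⟩ : p.toValuationSubring) := by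
  obtain ⟨hmem, hres⟩ := lemme_4_2 p hx h
  refine ⟨hmem, ?_⟩
  by_contra hu
  exact hres ((IsLocalRing.residue_eq_zero_iff _).2 ((IsLocalRing.mem_maximalIdeal _).2 hu))

/-- Lemme 4.2 for the inverse as well ("non seulement les points `γ₁, …, γ_N` mais aussi leurs
inverses ont leurs coordonnées dans `𝒪`, et aucune … ne s'annule sous `r`", §5 p. 781): if
`h₁(x) < D` then both `x` and `x⁻¹` lie in `𝒪_𝔭`. [cite: RoyWaldschmidt1997ENS, Lemme 4.2, p. 773 and §5 p. 781] -/
theorem mem_and_inv_mem_of_affHeight_lt_degree [IsAlgFunctionField k K] (p : PlaceOver k K) {x : K}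
    (hx : x ≠ 0) (h : affHeight k ![x] < p.degree) :
    x ∈ p.toValuationSubring ∧ x⁻¹ ∈ p.toValuationSubring := by
  have h0 := ord_eq_zero_of_affHeight_lt_degree p hx h
  refine ⟨?_, ?_⟩
  · rw [p.mem_toValuationSubring_iff_ord_nonneg hx, h0]
  · rw [p.mem_toValuationSubring_iff_ord_nonneg (inv_ne_zero hx), p.ord_inv hx, h0, neg_zero]

/-- Tuple form of Lemme 4.2: if `h₁(x) < deg 𝔭` then every coordinate of `x` lies in `𝒪_𝔭`
(and the nonzero ones are units there, by `lemme_4_2` and `affHeight_apply_le`).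
[cite: RoyWaldschmidt1997ENS, Lemme 4.2, p. 773] -/
theorem forall_mem_of_affHeight_lt_degree [IsAlgFunctionField k K] (p : PlaceOver k K)
    {x : ι → K} (h : affHeight k x < p.degree) (i : ι) : x i ∈ p.toValuationSubring := by
  by_cases hi : x i = 0
  · rw [hi]; exact zero_mem _
  exact (mem_and_inv_mem_of_affHeight_lt_degree p hi ((affHeight_apply_le x i).trans_lt h)).1

end RoyWaldschmidt1997

end Literature.NumberTheory.Transcendental
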